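import Literature.Computability.QuantumComplexity.ZXCalculusParallelTriangles
import HarnessLib

/-!
# ZX-calculus, Layer T8: Appendix Lemma 37 (the fork of triangles absorbs an (anti-)CNOT)

[cite: JeandelPerdrixVilmart2018, Appendix Lemma 37]; proof architecture after Jeandel–Perdrix–Vilmart,
arXiv:1705.11151 (v2), Appendix (figs. `ug-fork-absorbs-CNOT-proof`, `-2`, `ug-fork-absorbs-anti-CNOT-proof`),
worked in the transposed orientation: (B2) on the CNOT, colour change, (C1), and the double Hadamard edge
(`sqrt_two_sq_par_czGadget_seq_czGadget`).
-/

namespace Literature.Computability.QuantumComplexity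

open ZXDiagram

namespace ZXClass

/-- A unit scalar cancels in front of `2 → 1` maps. [cite: JeandelPerdrixVilmart2018, Appendix Lemmas 5, 6] -/
theorem cancel_dumbbell_four_two_one (a : ZMod 8) {A B : ZXClass 2 1}
    (h : mk (dumbbell 4 a) ⊠ A = mk (dumbbell 4 a) ⊠ B) : A = B := by
  have h' : mk (dumbbell 4 (-a)) ⊠ (mk (dumbbell 4 a) ⊠ A) = mk (dumbbell 4 (-a)) ⊠ (mk (dumbbell 4 a) ⊠ B) := by rw [h]
  have e : ∀ C : ZXClass 2 1, mk (dumbbell 4 (-a)) ⊠ (mk (dumbbell 4 a) ⊠ C) = mk (dumbbell 0 0) ⊠ (mk (dumbbell 0 0) ⊠ C) := by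
    intro C
    rw [show mk (dumbbell 4 (-a)) ⊠ (mk (dumbbell 4 a) ⊠ C) = (mk (dumbbell 4 (-a)) ⊠ mk (dumbbell 4 a)) ⊠ C from
        (par_assoc' _ _ _).trans (cast_id _ _ _), dumbbell_four_mul, neg_add_cancel, dumbbell_four_zero]
    exact (par_assoc _ _ _).trans (cast_id _ _ _)
  rw [e, e] at h'
  exact cancel_sqrt_two_two_one (cancel_sqrt_two_two_one h')

/-- **The other CNOT followed by a Hadamard on the first wire is a Hadamard followed by the `CZ` gadget**:
`((X^{(1,2)} ⊗ 𝕀) ⨾ (𝕀 ⊗ Z^{(2,1)})) ⨾ (H ⊗ 𝕀) = (H ⊗ 𝕀) ⨾ CZg`. [cite: JeandelPerdrixVilmart2018, Fig. 1 (H)] -/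
theorem notC_seq_hBox_par :
    ((mk (X 1 2 0) ⊠ mk (wires 1)) ⨟ (mk (wires 1) ⊠ mk (Z 2 1 0))) ⨟ (mk hBox ⊠ mk (wires 1)) =
      (mk hBox ⊠ mk (wires 1)) ⨟ ((mk (Z 1 2 0) ⊠ mk (wires 1)) ⨟ ((mk (wires 1) ⊠ mk hBox) ⊠ mk (wires 1)) ⨟ (mk (wires 1) ⊠ mk (Z 2 1 0))) := by
  rw [X_split_eq, seq_par_wires, seq_par_wires, par_eq_seq_right (mk hBox) (mk hBox), seq_par_wires,
    show (mk hBox ⊠ mk (wires 1)) ⊠ mk (wires 1) = mk hBox ⊠ mk (wires 2) from by rw [← wires_par_wires 1 1]; exact (par_assoc _ _ _).trans (cast_id _ _ _)]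
  simp only [seq_assoc]
  rw [← seq_assoc (mk hBox ⊠ mk (wires 2)) (mk (wires 1) ⊠ mk (Z 2 1 0)) (mk hBox ⊠ mk (wires 1)),
    show (mk hBox ⊠ mk (wires 2)) ⨟ (mk (wires 1) ⊠ mk (Z 2 1 0)) = (mk (wires 1) ⊠ mk (Z 2 1 0)) ⨟ (mk hBox ⊠ mk (wires 1)) from by
      rw [← par_eq_seq_right, ← par_eq_seq_left],
    seq_assoc (mk (wires 1) ⊠ mk (Z 2 1 0)), hBox_par_seq_hBox_par, seq_id]

/-- **The mirrored other CNOT with the Eulered phases is the hedge**: `Cton ⨾ (Z(π/4) ⊗ (H ⨾ Z(-π/4))) = (𝕀 ⊗ H) ⨾ (Z^{(1,2)}(π/4) ⊗ Z^{(1,2)}(-π/4)) ⨾ hedge`.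
[cite: JeandelPerdrixVilmart2018, Appendix Lemma 37 (proof)] -/
theorem cton_seq_phases_eq :
    ((mk (wires 1) ⊠ mk (X 1 2 0)) ⨟ (mk (Z 2 1 0) ⊠ mk (wires 1))) ⨟ (mk (Z 1 1 1) ⊠ (mk hBox ⨟ mk (Z 1 1 (-1)))) =
      (mk (wires 1) ⊠ mk hBox) ⨟ (mk (Z 1 2 1) ⊠ mk (Z 1 2 (-1))) ⨟ ((mk (wires 1) ⊠ ((mk hBox ⊠ mk (wires 1)) ⨟ mk cap)) ⊠ mk (wires 1)) := by
  rw [X_split_eq, wires_par_seq, wires_par_seq, par_eq_seq_left (mk hBox) (mk hBox), wires_par_seq,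
    show mk (wires 1) ⊠ (mk (wires 1) ⊠ mk hBox) = mk (wires 2) ⊠ mk hBox from by rw [← wires_par_wires 1 1]; exact (par_assoc' _ _ _).trans (cast_id _ _ _)]
  simp only [seq_assoc]
  rw [← seq_assoc (mk (wires 2) ⊠ mk hBox) (mk (Z 2 1 0) ⊠ mk (wires 1)),
    show (mk (wires 2) ⊠ mk hBox) ⨟ (mk (Z 2 1 0) ⊠ mk (wires 1)) = (mk (Z 2 1 0) ⊠ mk (wires 1)) ⨟ (mk (wires 1) ⊠ mk hBox) from by
      rw [← par_eq_seq_right, ← par_eq_seq_left],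
    seq_assoc (mk (Z 2 1 0) ⊠ mk (wires 1)),
    show (mk (wires 1) ⊠ mk hBox) ⨟ (mk (Z 1 1 1) ⊠ (mk hBox ⨟ mk (Z 1 1 (-1)))) = mk (Z 1 1 1) ⊠ mk (Z 1 1 (-1)) from by
      rw [interchange, id_seq, ← seq_assoc, hBox_seq_hBox, id_seq],
    ← seq_assoc (mk (wires 1) ⊠ mk (Z 1 2 0)) (mk (wires 1) ⊠ (mk hBox ⊠ mk (wires 1))), ← wires_par_seq,
    ← seq_assoc (mk (wires 1) ⊠ (mk (Z 1 2 0) ⨟ (mk hBox ⊠ mk (wires 1)))) (mk (Z 2 1 0) ⊠ mk (wires 1)), czGadgetMirror_eq_hedgeSq,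
    hedgeSq_seq_phases]

/-- **The Hopf step of Lemma 37**: `2 ⊗ (notC ⨾ (H ⊗ 𝕀) ⨾ (Z^{(1,2)}(-π/4) ⊗ Z^{(1,2)}(π/4)) ⨾ hedge) = (H ⨾ Z(-π/4)) ⊗ Z(π/4)`
(two parallel Hadamard edges disconnect). [cite: JeandelPerdrixVilmart2018, Appendix Lemmas 2, 37 (proof)] -/
theorem notC_hBox_splits_hedgecap :
    mk (dumbbell 0 0) ⊠ (mk (dumbbell 0 0) ⊠ (((mk (X 1 2 0) ⊠ mk (wires 1)) ⨟ (mk (wires 1) ⊠ mk (Z 2 1 0))) ⨟ (mk hBox ⊠ mk (wires 1)) ⨟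
      (mk (Z 1 2 (-1)) ⊠ mk (Z 1 2 1)) ⨟ ((mk (wires 1) ⊠ ((mk hBox ⊠ mk (wires 1)) ⨟ mk cap)) ⊠ mk (wires 1)))) =
      (mk hBox ⨟ mk (Z 1 1 (-1))) ⊠ mk (Z 1 1 1) := by
  rw [notC_seq_hBox_par, seq_assoc _ (mk (Z 1 2 (-1)) ⊠ mk (Z 1 2 1)), ← hedgeSq_seq_phases, ← czGadget_eq_hedgeSq,
    seq_assoc (mk hBox ⊠ mk (wires 1)), ← seq_assoc ((mk (Z 1 2 0) ⊠ mk (wires 1)) ⨟ ((mk (wires 1) ⊠ mk hBox) ⊠ mk (wires 1)) ⨟ (mk (wires 1) ⊠ mk (Z 2 1 0))),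
    two_two_seq_scalar_par_two', two_two_seq_scalar_par_two', ← scalar_par_two_two_seq_two (mk (dumbbell 0 0)) _ (mk (Z 1 1 (-1)) ⊠ mk (Z 1 1 1)),
    ← scalar_par_two_two_seq_two (mk (dumbbell 0 0)) _ (mk (Z 1 1 (-1)) ⊠ mk (Z 1 1 1)), sqrt_two_sq_par_czGadget_seq_czGadget, id_seq,
    interchange, id_seq]
  where
  two_two_seq_scalar_par_two' (A : ZXClass 2 2) (s : ZXClass 0 0) (B : ZXClass 2 2) : s ⊠ (A ⨟ B) = A ⨟ (s ⊠ B) := (two_two_seq_scalar_par_two A s B).symm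

/-- The crossing exchanges the two drawings of the other CNOT: `σ ⨾ notC = Cton ⨾ σ`. [cite: JeandelPerdrixVilmart2018, §2.2] -/
theorem swap_seq_notC : mk swap ⨟ ((mk (X 1 2 0) ⊠ mk (wires 1)) ⨟ (mk (wires 1) ⊠ mk (Z 2 1 0))) = ((mk (wires 1) ⊠ mk (X 1 2 0)) ⨟ (mk (Z 2 1 0) ⊠ mk (wires 1))) ⨟ mk swap := by
  have hl : mk swap ⨟ ((mk (X 1 2 0) ⊠ mk (wires 1)) ⨟ (mk (wires 1) ⊠ mk (Z 2 1 0))) = (mk (wires 1) ⊠ mk (X 1 2 0)) ⨟ (mk swap ⊠ mk (wires 1)) ⨟ (mk (wires 1) ⊠ mk (Z 2 1 0)) := by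
    rw [← seq_assoc, ← fswap1_one, fswap1_nat, fswap1_two, seq_assoc, seq_assoc, ← wires_par_seq, fswap1_one, swap_seq_Z, ← seq_assoc]
  have hr : ((mk (wires 1) ⊠ mk (X 1 2 0)) ⨟ (mk (Z 2 1 0) ⊠ mk (wires 1))) ⨟ mk swap = (mk (wires 1) ⊠ mk (X 1 2 0)) ⨟ (mk swap ⊠ mk (wires 1)) ⨟ (mk (wires 1) ⊠ mk (Z 2 1 0)) := by
    rw [seq_assoc, show (mk (Z 2 1 0) ⊠ mk (wires 1)) ⨟ mk swap = ((mk (wires 1) ⊠ mk swap) ⨟ (mk swap ⊠ mk (wires 1))) ⨟ (mk (wires 1) ⊠ mk (Z 2 1 0)) from by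
        rw [← bswap1_one, ← bswap1_seq_wires_par, bswap1_two, bswap1_one],
      ← seq_assoc, ← seq_assoc, ← wires_par_seq, X_seq_swap]
  rw [hl, hr]

/-- **Core of Lemma 37 (transposed)**: the CNOT is absorbed,
`√2 ⊗ (CNOT ⨾ ((H ⨾ Z(-π/4)) ⊗ Z(π/4)) ⨾ (xLeafL 0 (π/4) ⊗ xLeafL 0 (π/4)) ⨾ Z^{(2,1)}) = ((H ⨾ Z(-π/4)) ⊗ Z(π/4)) ⨾ (xLeafL 0 (π/4))^{⊗2} ⨾ Z^{(2,1)}`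
((B2), colour change, (C1), Hopf). [cite: JeandelPerdrixVilmart2018, Appendix Lemma 37 (proof, first part)] -/
theorem core37 :
    mk (dumbbell 0 0) ⊠ (((mk (Z 1 2 0) ⊠ mk (wires 1)) ⨟ (mk (wires 1) ⊠ mk (X 2 1 0))) ⨟
      (((mk hBox ⨟ mk (Z 1 1 (-1))) ⊠ mk (Z 1 1 1)) ⨟ (mk (xLeafL 0 1) ⊠ mk (xLeafL 0 1)) ⨟ mk (Z 2 1 0))) =
      ((mk hBox ⨟ mk (Z 1 1 (-1))) ⊠ mk (Z 1 1 1)) ⨟ (mk (xLeafL 0 1) ⊠ mk (xLeafL 0 1)) ⨟ mk (Z 2 1 0) := by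
  have hK : mk (dumbbell 4 (-1)) ⊠ mk (xLeafL 0 1) = mk (dumbbell 0 0) ⊠ mk (xLeafL 4 (-1)) := by
    simpa using (dumbbell_four_par_xLeafL_neg 0 (-1))
  have hsw : mk swap ⨟ (((mk hBox ⨟ mk (Z 1 1 (-1))) ⊠ mk (Z 1 1 1)) ⨟ (mk (xLeafL 0 1) ⊠ mk (xLeafL 0 1)) ⨟ mk (Z 2 1 0)) =
      (mk (Z 1 1 1) ⊠ (mk hBox ⨟ mk (Z 1 1 (-1)))) ⨟ (mk (xLeafL 0 1) ⊠ mk (xLeafL 0 1)) ⨟ mk (Z 2 1 0) := by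
    rw [seq_assoc, ← seq_assoc (mk swap), swap_seq_par_one_one, seq_assoc, ← seq_assoc (mk swap), swap_seq_par_one_one, seq_assoc, swap_seq_Z,
      ← seq_assoc]
  have hRl : ∀ (A B : ZXClass 1 1) (t : ZXClass 0 0), A ⊠ (t ⊠ B) = t ⊠ (A ⊠ B) := fun A B t => by
    rw [show A ⊠ (t ⊠ B) = (A ⊠ t) ⊠ B from (par_assoc' _ _ _).trans (cast_id _ _ _), ← scalar_par_one_comm]
    exact (par_assoc _ _ _).trans (cast_id _ _ _)
  refine cancel_dumbbell_four_two_one (-1) ?_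
  conv_lhs =>
    rw [rule_B2_cnot, scalar_par_two_two_seq_one, seq_assoc (((mk (X 1 2 0) ⊠ mk (wires 1)) ⨟ (mk (wires 1) ⊠ mk (Z 2 1 0))) ⨟ mk swap) ((mk (X 1 2 0) ⊠ mk (wires 1)) ⨟ (mk (wires 1) ⊠ mk (Z 2 1 0))), seq_assoc ((mk (X 1 2 0) ⊠ mk (wires 1)) ⨟ (mk (wires 1) ⊠ mk (Z 2 1 0))) (mk swap),
      ← seq_assoc (mk swap) ((mk (X 1 2 0) ⊠ mk (wires 1)) ⨟ (mk (wires 1) ⊠ mk (Z 2 1 0))), swap_seq_notC, seq_assoc ((mk (wires 1) ⊠ mk (X 1 2 0)) ⨟ (mk (Z 2 1 0) ⊠ mk (wires 1))) (mk swap), hsw,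
      ← seq_assoc ((mk (wires 1) ⊠ mk (X 1 2 0)) ⨟ (mk (Z 2 1 0) ⊠ mk (wires 1))) _ (mk (Z 2 1 0)), ← seq_assoc ((mk (wires 1) ⊠ mk (X 1 2 0)) ⨟ (mk (Z 2 1 0) ⊠ mk (wires 1))) _ (mk (xLeafL 0 1) ⊠ mk (xLeafL 0 1)), cton_seq_phases_eq,
      -- flip the right leaf with `db 4 (-1)`
      scalar_par_scalar_par (mk (dumbbell 4 (-1))) (mk (dumbbell 0 0)), scalar_par_scalar_par (mk (dumbbell 4 (-1))) (mk (dumbbell 0 0)),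
      ← two_two_seq_scalar_par_one, ← scalar_par_two_two_seq_one (mk (dumbbell 4 (-1))), ← two_two_seq_scalar_par_two, ← hRl, hK, hRl,
      xLeafL_eq_xLeafR 4 (-1), two_two_seq_scalar_par_two, scalar_par_two_two_seq_one, two_two_seq_scalar_par_one,
      -- (C1) backwards, then the Hopf step
      ← c1Gadget_eq_mirror, ← seq_assoc ((mk (X 1 2 0) ⊠ mk (wires 1)) ⨟ (mk (wires 1) ⊠ mk (Z 2 1 0))) _ (mk (Z 2 1 0)), ← seq_assoc ((mk (X 1 2 0) ⊠ mk (wires 1)) ⨟ (mk (wires 1) ⊠ mk (Z 2 1 0))) _ (mk (xLeafL 4 (-1)) ⊠ mk (xLeafR 0 1)),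
      ← seq_assoc ((mk (X 1 2 0) ⊠ mk (wires 1)) ⨟ (mk (wires 1) ⊠ mk (Z 2 1 0))) _ ((mk (wires 1) ⊠ ((mk hBox ⊠ mk (wires 1)) ⨟ mk cap)) ⊠ mk (wires 1)), ← seq_assoc ((mk (X 1 2 0) ⊠ mk (wires 1)) ⨟ (mk (wires 1) ⊠ mk (Z 2 1 0))) (mk hBox ⊠ mk (wires 1)) (mk (Z 1 2 (-1)) ⊠ mk (Z 1 2 1)),
      ← scalar_par_two_two_seq_one (mk (dumbbell 0 0)) _ (mk (Z 2 1 0)), ← scalar_par_two_two_seq_two (mk (dumbbell 0 0)) _ (mk (xLeafL 4 (-1)) ⊠ mk (xLeafR 0 1)),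
      ← scalar_par_two_two_seq_one (mk (dumbbell 0 0)) _ (mk (Z 2 1 0)), ← scalar_par_two_two_seq_two (mk (dumbbell 0 0)) _ (mk (xLeafL 4 (-1)) ⊠ mk (xLeafR 0 1)),
      notC_hBox_splits_hedgecap]
  conv_rhs =>
    rw [← scalar_par_two_two_seq_one, ← two_two_seq_scalar_par_two, ← scalar_par_one_par_one, hK, scalar_par_one_par_one, xLeafL_eq_xLeafR 0 1,
      two_two_seq_scalar_par_two, scalar_par_two_two_seq_one]

/-- Phases on the outputs of the CNOT that match its spiders move to its inputs:
`CNOT ⨾ (Z(α) ⊗ X(β)) = (Z(α) ⊗ X(β)) ⨾ CNOT`. [cite: JeandelPerdrixVilmart2018, Fig. 1 (S1)] -/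
theorem cnot_seq_phases (a b : ZMod 8) : ((mk (Z 1 2 0) ⊠ mk (wires 1)) ⨟ (mk (wires 1) ⊠ mk (X 2 1 0))) ⨟ (mk (Z 1 1 a) ⊠ mk (X 1 1 b)) = (mk (Z 1 1 a) ⊠ mk (X 1 1 b)) ⨟ ((mk (Z 1 2 0) ⊠ mk (wires 1)) ⨟ (mk (wires 1) ⊠ mk (X 2 1 0))) := by
  rw [seq_assoc, interchange, id_seq, X_seq_X 2 1 1 le_rfl, zero_add,
    show mk (X 2 1 b) = (mk (wires 1) ⊠ mk (X 1 1 b)) ⨟ mk (X 2 1 0) from by rw [par_X_seq_X 1 1 1 1 le_rfl, zero_add],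
    show mk (Z 1 1 a) ⊠ ((mk (wires 1) ⊠ mk (X 1 1 b)) ⨟ mk (X 2 1 0)) = ((mk (Z 1 1 a) ⊠ mk (wires 1)) ⊠ mk (X 1 1 b)) ⨟ (mk (wires 1) ⊠ mk (X 2 1 0)) from by
      rw [show mk (Z 1 1 a) ⊠ ((mk (wires 1) ⊠ mk (X 1 1 b)) ⨟ mk (X 2 1 0)) = (mk (Z 1 1 a) ⨟ mk (wires 1)) ⊠ ((mk (wires 1) ⊠ mk (X 1 1 b)) ⨟ mk (X 2 1 0)) from by
          rw [seq_id], ← interchange]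
      exact congrArg (· ⨟ (mk (wires 1) ⊠ mk (X 2 1 0))) ((par_assoc' _ _ _).trans (cast_id _ _ _)),
    ← seq_assoc, interchange, id_seq, Z_seq_Z_par 1 1 1 1 le_rfl, add_zero a,
    show mk (Z 1 2 a) = mk (Z 1 1 a) ⨟ mk (Z 1 2 0) from by rw [Z_seq_Z 1 1 2 le_rfl, add_zero],
    show mk (X 1 1 b) = mk (X 1 1 b) ⨟ mk (wires 1) from (seq_id _).symm, ← interchange, seq_id, seq_assoc]

/-- **Lemma 37, first part, transposed**: the merge of two transposed triangles-without-gadget absorbs a CNOT: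
`√2 ⊗ (CNOT ⨾ (N' ⊗ N') ⨾ Z^{(2,1)}) = (N' ⊗ N') ⨾ Z^{(2,1)}` with `N' = X(π/2) ⨾ Z(π/4) ⨾ xLeafL 0 (π/4)`.
[cite: JeandelPerdrixVilmart2018, Appendix Lemma 37 (proof, first part)] -/
theorem first37T : mk (dumbbell 0 0) ⊠ (((mk (Z 1 2 0) ⊠ mk (wires 1)) ⨟ (mk (wires 1) ⊠ mk (X 2 1 0))) ⨟ (((mk (X 1 1 2) ⨟ mk (Z 1 1 1) ⨟ mk (xLeafL 0 1)) ⊠ (mk (X 1 1 2) ⨟ mk (Z 1 1 1) ⨟ mk (xLeafL 0 1))) ⨟ mk (Z 2 1 0))) = ((mk (X 1 1 2) ⨟ mk (Z 1 1 1) ⨟ mk (xLeafL 0 1)) ⊠ (mk (X 1 1 2) ⨟ mk (Z 1 1 1) ⨟ mk (xLeafL 0 1))) ⨟ mk (Z 2 1 0) := by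
  have hN : (mk (X 1 1 2) ⨟ mk (Z 1 1 1) ⨟ mk (xLeafL 0 1)) = mk (Z 1 1 (-2)) ⨟ (mk invSqrtTwo ⊠ (mk (dumbbell 4 1) ⊠ ((mk hBox ⨟ mk (Z 1 1 (-1))) ⨟ mk (xLeafL 0 1)))) := by
    rw [X_halfpi_eq_euler]
    simp only [seq_assoc]
    rw [scalar_par_seq_one, scalar_par_seq_one, ← seq_assoc (mk (Z 1 1 (-2))) (mk (Z 1 1 1)) (mk (xLeafL 0 1)), phase_seq_phase,
      show (-2 : ZMod 8) + 1 = -1 from by decide, ← seq_assoc (mk hBox) (mk (Z 1 1 (-1))) (mk (xLeafL 0 1))]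
  have hM : ((mk (X 1 1 2) ⨟ mk (Z 1 1 1) ⨟ mk (xLeafL 0 1)) ⊠ (mk (X 1 1 2) ⨟ mk (Z 1 1 1) ⨟ mk (xLeafL 0 1))) ⨟ mk (Z 2 1 0) = mk invSqrtTwo ⊠ (mk (dumbbell 4 1) ⊠ ((mk (Z 1 1 (-2)) ⊠ mk (X 1 1 2)) ⨟ (((mk hBox ⨟ mk (Z 1 1 (-1))) ⊠ mk (Z 1 1 1)) ⨟ (mk (xLeafL 0 1) ⊠ mk (xLeafL 0 1)) ⨟ mk (Z 2 1 0)))) := by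
    nth_rewrite 1 [hN]
    rw [seq_assoc (mk (X 1 1 2)) (mk (Z 1 1 1)) (mk (xLeafL 0 1)), ← interchange,
      show ∀ (t : ZXClass 0 0) (A B : ZXClass 1 1), (t ⊠ A) ⊠ B = t ⊠ (A ⊠ B) from fun t A B => (par_assoc _ _ _).trans (cast_id _ _ _),
      show ∀ (t : ZXClass 0 0) (A B : ZXClass 1 1), (t ⊠ A) ⊠ B = t ⊠ (A ⊠ B) from fun t A B => (par_assoc _ _ _).trans (cast_id _ _ _),
      two_two_seq_scalar_par_two, two_two_seq_scalar_par_two, scalar_par_two_two_seq_one, scalar_par_two_two_seq_one,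
      show ((mk hBox ⨟ mk (Z 1 1 (-1))) ⨟ mk (xLeafL 0 1)) ⊠ (mk (Z 1 1 1) ⨟ mk (xLeafL 0 1)) = ((mk hBox ⨟ mk (Z 1 1 (-1))) ⊠ mk (Z 1 1 1)) ⨟ (mk (xLeafL 0 1) ⊠ mk (xLeafL 0 1))
        from by rw [← interchange], seq_assoc (mk (Z 1 1 (-2)) ⊠ mk (X 1 1 2)) _ (mk (Z 2 1 0))]
  rw [hM, two_two_seq_scalar_par_one, two_two_seq_scalar_par_one, ← seq_assoc ((mk (Z 1 2 0) ⊠ mk (wires 1)) ⨟ (mk (wires 1) ⊠ mk (X 2 1 0))), cnot_seq_phases, seq_assoc,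
    scalar_par_scalar_par (mk (dumbbell 0 0)) (mk invSqrtTwo), scalar_par_scalar_par (mk (dumbbell 0 0)) (mk (dumbbell 4 1)),
    ← two_two_seq_scalar_par_one, core37]

/-- The gadget commutes through the merge (first input). [cite: JeandelPerdrixVilmart2018, Fig. 1 (S1)] -/
theorem gadget_par_seq_merge : ((mk (Z 1 2 0) ⨟ (mk (wires 1) ⊠ (mk (X 1 2 0) ⨟ (mk (Z 1 0 (-1)) ⊠ mk (Z 1 0 (-1)))))) ⊠ mk (wires 1)) ⨟ mk (Z 2 1 0) = mk (Z 2 1 0) ⨟ (mk (Z 1 2 0) ⨟ (mk (wires 1) ⊠ (mk (X 1 2 0) ⨟ (mk (Z 1 0 (-1)) ⊠ mk (Z 1 0 (-1)))))) := by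
  have h := congrArg transpose (split_seq_gadget_par (mk (X 1 2 0) ⨟ (mk (Z 1 0 (-1)) ⊠ mk (Z 1 0 (-1)))))
  simp at h
  rw [par_gadget_transpose_seq_merge] at h
  exact h

/-- The gadget commutes through the merge (second input). [cite: JeandelPerdrixVilmart2018, Fig. 1 (S1)] -/
theorem par_gadget_seq_merge : (mk (wires 1) ⊠ (mk (Z 1 2 0) ⨟ (mk (wires 1) ⊠ (mk (X 1 2 0) ⨟ (mk (Z 1 0 (-1)) ⊠ mk (Z 1 0 (-1))))))) ⨟ mk (Z 2 1 0) = mk (Z 2 1 0) ⨟ (mk (Z 1 2 0) ⨟ (mk (wires 1) ⊠ (mk (X 1 2 0) ⨟ (mk (Z 1 0 (-1)) ⊠ mk (Z 1 0 (-1)))))) := by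
  have h := congrArg transpose split_seq_par_gadget
  simp at h
  rw [par_gadget_transpose_seq_merge] at h
  exact h

/-- **Appendix Lemma 37 (transposed triangles)**: the merge of two transposed triangles absorbs a CNOT,
`√2 ⊗ (CNOT ⨾ (Tᵗ ⊗ Tᵗ) ⨾ Z^{(2,1)}) = (Tᵗ ⊗ Tᵗ) ⨾ Z^{(2,1)}`. [cite: JeandelPerdrixVilmart2018, Appendix Lemma 37] -/
theorem cnot_seq_transposes_seq_merge :
    mk (dumbbell 0 0) ⊠ (((mk (Z 1 2 0) ⊠ mk (wires 1)) ⨟ (mk (wires 1) ⊠ mk (X 2 1 0))) ⨟ (((mk triangle).transpose ⊠ (mk triangle).transpose) ⨟ mk (Z 2 1 0))) =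
      ((mk triangle).transpose ⊠ (mk triangle).transpose) ⨟ mk (Z 2 1 0) := by
  have hF : ((mk triangle).transpose ⊠ (mk triangle).transpose) ⨟ mk (Z 2 1 0) = ((mk (X 1 1 2) ⨟ mk (Z 1 1 1) ⨟ mk (xLeafL 0 1)) ⊠ (mk (X 1 1 2) ⨟ mk (Z 1 1 1) ⨟ mk (xLeafL 0 1))) ⨟ (mk (Z 2 1 0) ⨟ ((mk (Z 1 2 0) ⨟ (mk (wires 1) ⊠ (mk (X 1 2 0) ⨟ (mk (Z 1 0 (-1)) ⊠ mk (Z 1 0 (-1)))))) ⨟ (mk (Z 1 2 0) ⨟ (mk (wires 1) ⊠ (mk (X 1 2 0) ⨟ (mk (Z 1 0 (-1)) ⊠ mk (Z 1 0 (-1)))))))) := by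
    rw [triangle_transpose_explicit, ← interchange, seq_assoc, par_eq_seq_left (mk (Z 1 2 0) ⨟ (mk (wires 1) ⊠ (mk (X 1 2 0) ⨟ (mk (Z 1 0 (-1)) ⊠ mk (Z 1 0 (-1)))))) (mk (Z 1 2 0) ⨟ (mk (wires 1) ⊠ (mk (X 1 2 0) ⨟ (mk (Z 1 0 (-1)) ⊠ mk (Z 1 0 (-1)))))), show mk (wires (1 + (0 + 0))) = mk (wires 1) from rfl,
      seq_assoc ((mk (Z 1 2 0) ⨟ (mk (wires 1) ⊠ (mk (X 1 2 0) ⨟ (mk (Z 1 0 (-1)) ⊠ mk (Z 1 0 (-1)))))) ⊠ mk (wires 1)) (mk (wires 1) ⊠ (mk (Z 1 2 0) ⨟ (mk (wires 1) ⊠ (mk (X 1 2 0) ⨟ (mk (Z 1 0 (-1)) ⊠ mk (Z 1 0 (-1))))))) (mk (Z 2 1 0)), par_gadget_seq_merge, ← seq_assoc ((mk (Z 1 2 0) ⨟ (mk (wires 1) ⊠ (mk (X 1 2 0) ⨟ (mk (Z 1 0 (-1)) ⊠ mk (Z 1 0 (-1)))))) ⊠ mk (wires 1)),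
      gadget_par_seq_merge]
    simp only [seq_assoc]
  rw [hF, ← seq_assoc ((mk (X 1 1 2) ⨟ mk (Z 1 1 1) ⨟ mk (xLeafL 0 1)) ⊠ (mk (X 1 1 2) ⨟ mk (Z 1 1 1) ⨟ mk (xLeafL 0 1))) (mk (Z 2 1 0)), ← seq_assoc ((mk (Z 1 2 0) ⊠ mk (wires 1)) ⨟ (mk (wires 1) ⊠ mk (X 2 1 0))) _ ((mk (Z 1 2 0) ⨟ (mk (wires 1) ⊠ (mk (X 1 2 0) ⨟ (mk (Z 1 0 (-1)) ⊠ mk (Z 1 0 (-1)))))) ⨟ (mk (Z 1 2 0) ⨟ (mk (wires 1) ⊠ (mk (X 1 2 0) ⨟ (mk (Z 1 0 (-1)) ⊠ mk (Z 1 0 (-1))))))), ← scalar_par_two_one_seq_one, first37T]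

/-- Red `π`'s on both inputs of the CNOT are a red `π` on its control output... input: `(X(π) ⊗ X(π)) ⨾ CNOT = CNOT ⨾ (X(π) ⊗ 𝕀)` read backwards,
i.e. `CNOT ⨾ (X(π) ⊗ 𝕀) = (X(π) ⊗ X(π)) ⨾ CNOT`. [cite: JeandelPerdrixVilmart2018, Fig. 1 (K1)] -/
theorem cnot_seq_X_pi_par : ((mk (Z 1 2 0) ⊠ mk (wires 1)) ⨟ (mk (wires 1) ⊠ mk (X 2 1 0))) ⨟ (mk (X 1 1 4) ⊠ mk (wires 1)) = (mk (X 1 1 4) ⊠ mk (X 1 1 4)) ⨟ ((mk (Z 1 2 0) ⊠ mk (wires 1)) ⨟ (mk (wires 1) ⊠ mk (X 2 1 0))) := by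
  have hZ : mk (Z 1 2 0) ⨟ (mk (X 1 1 4) ⊠ mk (wires 1)) = mk (X 1 1 4) ⨟ mk (Z 1 2 0) ⨟ (mk (wires 1) ⊠ mk (X 1 1 4)) := by
    rw [K1_red, seq_assoc, par_eq_seq_left (mk (X 1 1 4)) (mk (X 1 1 4)), seq_assoc, ← wires_par_seq, xphase_seq_xphase,
      show (4 : ZMod 8) + 4 = 0 from by decide, X_one_one, wires_par_wires, seq_id]
  have hL : ((mk (Z 1 2 0) ⊠ mk (wires 1)) ⨟ (mk (wires 1) ⊠ mk (X 2 1 0))) ⨟ (mk (X 1 1 4) ⊠ mk (wires 1)) = (mk (X 1 1 4) ⊠ mk (wires 1)) ⨟ (mk (Z 1 2 0) ⊠ mk (wires 1)) ⨟ (mk (wires 1) ⊠ mk (X 2 1 4)) := by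
    rw [seq_assoc, interchange, id_seq, seq_id, par_eq_seq_left (mk (X 1 1 4)) (mk (X 2 1 0)), ← seq_assoc, ← wires_par_wires 1 1,
      show mk (X 1 1 4) ⊠ (mk (wires 1) ⊠ mk (wires 1)) = (mk (X 1 1 4) ⊠ mk (wires 1)) ⊠ mk (wires 1) from (par_assoc' _ _ _).trans (cast_id _ _ _),
      ← seq_par_wires, hZ, seq_par_wires, seq_par_wires, seq_assoc,
      show (mk (wires 1) ⊠ mk (X 1 1 4)) ⊠ mk (wires 1) = mk (wires 1) ⊠ (mk (X 1 1 4) ⊠ mk (wires 1)) from (par_assoc _ _ _).trans (cast_id _ _ _),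
      ← wires_par_seq, X_par_seq_X 1 1 1 1 le_rfl, add_zero]
  have hR : (mk (X 1 1 4) ⊠ mk (X 1 1 4)) ⨟ ((mk (Z 1 2 0) ⊠ mk (wires 1)) ⨟ (mk (wires 1) ⊠ mk (X 2 1 0))) = (mk (X 1 1 4) ⊠ mk (wires 1)) ⨟ (mk (Z 1 2 0) ⊠ mk (wires 1)) ⨟ (mk (wires 1) ⊠ mk (X 2 1 4)) := by
    rw [par_eq_seq_left (mk (X 1 1 4)) (mk (X 1 1 4)), seq_assoc, ← seq_assoc (mk (wires 1) ⊠ mk (X 1 1 4)) (mk (Z 1 2 0) ⊠ mk (wires 1)) (mk (wires 1) ⊠ mk (X 2 1 0)),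
      show (mk (wires 1) ⊠ mk (X 1 1 4)) ⨟ (mk (Z 1 2 0) ⊠ mk (wires 1)) = (mk (Z 1 2 0) ⊠ mk (wires 1)) ⨟ (mk (wires 2) ⊠ mk (X 1 1 4)) from by
        rw [← par_eq_seq_right, ← par_eq_seq_left],
      seq_assoc (mk (Z 1 2 0) ⊠ mk (wires 1)), ← wires_par_wires 1 1,
      show (mk (wires 1) ⊠ mk (wires 1)) ⊠ mk (X 1 1 4) = mk (wires 1) ⊠ (mk (wires 1) ⊠ mk (X 1 1 4)) from (par_assoc _ _ _).trans (cast_id _ _ _),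
      ← wires_par_seq, par_X_seq_X 1 1 1 1 le_rfl, zero_add, ← seq_assoc]
  exact hL.trans hR.symm

/-- Red `π`'s on both inputs of the merge. [cite: JeandelPerdrixVilmart2018, Fig. 1 (K1)] -/
theorem X_pi_par_X_pi_seq_Z_merge : (mk (X 1 1 4) ⊠ mk (X 1 1 4)) ⨟ mk (Z 2 1 0) = mk (Z 2 1 0) ⨟ mk (X 1 1 4) := by
  have h := congrArg transpose K1_red
  simp at h
  exact h.symm

/-- **Appendix Lemma 37** (`triangles-fork-absorbs-anti-CNOT`): the merge of two triangles absorbs an anti-CNOT,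
`√2 ⊗ (((Z^{(1,2)} ⊗ 𝕀) ⨾ (𝕀 ⊗ X^{(2,1)}(π))) ⨾ (T ⊗ T) ⨾ Z^{(2,1)}) = (T ⊗ T) ⨾ Z^{(2,1)}`.
[cite: JeandelPerdrixVilmart2018, Appendix Lemma 37] -/
theorem antiCnot_seq_triangles_seq_merge :
    mk (dumbbell 0 0) ⊠ (((mk (Z 1 2 0) ⊠ mk (wires 1)) ⨟ (mk (wires 1) ⊠ mk (X 2 1 4))) ⨟ ((mk triangle ⊠ mk triangle) ⨟ mk (Z 2 1 0))) =
      (mk triangle ⊠ mk triangle) ⨟ mk (Z 2 1 0) := by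
  have h1 : (mk (wires 1) ⊠ mk (X 1 1 4)) ⨟ (mk triangle ⊠ mk triangle) = (mk (X 1 1 4) ⊠ mk (wires 1)) ⨟ ((mk triangle).transpose ⊠ (mk triangle).transpose) ⨟ (mk (X 1 1 4) ⊠ mk (X 1 1 4)) := by
    rw [interchange, id_seq, X_pi_seq_triangle, seq_assoc, interchange, interchange, id_seq, ← seq_assoc (mk (X 1 1 4)) ((mk triangle).transpose),
      ← triangle_eq_conj_transpose]
  have hT : mk triangle ⊠ mk triangle = (mk (X 1 1 4) ⊠ mk (X 1 1 4)) ⨟ ((mk triangle).transpose ⊠ (mk triangle).transpose) ⨟ (mk (X 1 1 4) ⊠ mk (X 1 1 4)) := by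
    rw [seq_assoc, interchange, interchange, ← seq_assoc (mk (X 1 1 4)) ((mk triangle).transpose) (mk (X 1 1 4)), ← triangle_eq_conj_transpose]
  conv_lhs => rw [show mk (X 2 1 4) = mk (X 2 1 0) ⨟ mk (X 1 1 4) from by rw [X_seq_X 2 1 1 le_rfl, zero_add], wires_par_seq, ← seq_assoc (mk (Z 1 2 0) ⊠ mk (wires 1)),
    seq_assoc ((mk (Z 1 2 0) ⊠ mk (wires 1)) ⨟ (mk (wires 1) ⊠ mk (X 2 1 0))), ← seq_assoc (mk (wires 1) ⊠ mk (X 1 1 4)), h1, seq_assoc _ (mk (X 1 1 4) ⊠ mk (X 1 1 4)) (mk (Z 2 1 0)), X_pi_par_X_pi_seq_Z_merge,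
    seq_assoc (mk (X 1 1 4) ⊠ mk (wires 1)), ← seq_assoc ((mk (Z 1 2 0) ⊠ mk (wires 1)) ⨟ (mk (wires 1) ⊠ mk (X 2 1 0))), cnot_seq_X_pi_par, seq_assoc (mk (X 1 1 4) ⊠ mk (X 1 1 4)),
    ← seq_assoc ((mk triangle).transpose ⊠ (mk triangle).transpose) (mk (Z 2 1 0)) (mk (X 1 1 4)), ← seq_assoc ((mk (Z 1 2 0) ⊠ mk (wires 1)) ⨟ (mk (wires 1) ⊠ mk (X 2 1 0))) (((mk triangle).transpose ⊠ (mk triangle).transpose) ⨟ mk (Z 2 1 0)) (mk (X 1 1 4)), ← two_two_seq_scalar_par_one,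
    ← scalar_par_two_one_seq_one, cnot_seq_transposes_seq_merge]
  conv_rhs => rw [hT, seq_assoc, seq_assoc, X_pi_par_X_pi_seq_Z_merge, ← seq_assoc ((mk triangle).transpose ⊠ (mk triangle).transpose)]

end ZXClass

end Literature.Computability.QuantumComplexity
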